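import Summits.CriticalPhenomena.PercolationContinuityZ3.Theorems.PercNearOneGluingNoHeavyLowerTailQ44ComplementaryPacking
import Summits.CriticalPhenomena.PercolationContinuityZ3.Theorems.PercNearOneGluingNoHeavyLowerTailQ44WeightedCount
import HarnessLib
import HarnessLib.Audit.Tags

/-!
# The PRIMED kernels `W′`, `U′`, `S3′`: Conjecture W, the packing `U` and its sibling `S3` are not extreme

Support file for crux `stmt-CriticalPhenomena-4575` (master-family programme; Conjecture W = row `Q44` for all `n`,
fibre socket `TwoCopyMono.q44_cells_of_goodKernel` of `…Q44WeightedCount`; packings `U`, `S3` of `…Q44ComplementaryPacking`),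
seat `prim-l12-p6` gen 31; memo `run/shared/lean/prim/prim-l12/FROM-prim-l12-p6-g31-PRIMED-FAMILY.md`.

Cells as in `FourPointAtoms.pat4` (`0 ⊥, 1 cy, 2 by, 3 bc, 4 ay, 5 ac, 6 ab, 7 bcy, 8 ay|bc, 9 ac|by, 10 acy, 11 ab|cy, 12 aby,
13 abc, 14 abcy`).  FINDING of the memo (exact, exhaustive over all 70 363 677 monotone maps `2^4 → Π₄` and all 41 328 of `2^3`,
1 800 384 distinct type vectors): along every such map the antipodal pair types `(a|by|c ; ay|bc)`, `(ac|b|y ; ay|bc)` and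
`(ac|by ; ay|bc)` are ABSENT whenever the `W`-count is tight, the type `(ac|by ; ay|bc)` is absent whenever the `U`- or `S3`-count
is tight, and subtracting these types at full weight keeps the counts nonnegative — i.e. the STRENGTHENED rows
* `W′ := W − 2·(c₂c₈ + c₅c₈ + c₈c₉)`,  `U′ := U − c₈c₉`,  `S3′ := S3 − c₈c₉`
hold on all of `B_2, B_3, B_4` (lattice-general), on all monotone maps of `B_5` (SAT, kit j236463), on every graph fibre with
≤ 7 vertices and ≤ 11 edges (1 307 724 graphs) and 43 000 random multigraph fibres (≤ 9 vertices, ≤ 18 edges), and at law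
level on 3 800 exact multi-scale weighted graphs; moreover `W′`, `U′`, `S3′` span EXTREME rays (facets) of the cone of
`B_4`-valid linear type-count inequalities (the tight vectors span codimension 1), whereas `W`, `U`, `S3` do not (codimension
4, 2, 2).  The three primed rows are members of ONE two-parameter family `U′_{π'} − δ_π ≥ 0` (π, π' pairings; memo §2).

This file is the socket for the primed kernels:
* `TwoCopyMono.goodKernel_mono` — good kernels are closed upward (pointwise larger kernels are good);
* `TwoCopyMono.kerQ44P`, `kerUP`, `kerS3P` — the integer kernels of `2·W′`, `4·U′`, `4·S3′`, with `sum_ker*_cell` evaluations;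
* `TwoCopyMono.goodKernel_kerQ44_of_primed` (and `U`, `S3` versions) — `GoodKernel kerQ44P → GoodKernel kerQ44` etc.;
* `TwoCopyMono.q44P_cells_of_goodKernel` — the law-level reduction `GoodKernel kerQ44P → W′ ≥ 0` on every finite weighted
  graph, all `n`, and `q44_cells_of_goodKernel_primed` — `GoodKernel kerQ44P → 2·Q44 ≥ 0` (Conjecture W) for all `n`;
* `TwoCopyMono.ConjWPrime` (`@[conjecture]`, OPEN) — the fibre statement `GoodKernel kerQ44P`.
No sorries, no named facts, standard axioms; the hypotheses `GoodKernel _` are the open combinatorial statements.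
-/

namespace Summit.CriticalPhenomena.PercolationContinuityZ3.Theorems

namespace TwoCopyMono

open Finset FourPointAtoms

/-! ## Good kernels are closed upward -/

/-- The profile lift is monotone in the kernel. [this work] -/
theorem liftK_mono {κ κ' : Fin 15 → Fin 15 → ℤ} (h : ∀ i j, κ i j ≤ κ' i j) (u v : Prof) : liftK κ u v ≤ liftK κ' u v := by
  unfold liftK
  refine Finset.sum_le_sum fun i _ => Finset.sum_le_sum fun j _ => ?_
  split_ifs
  · exact h i j
  · exact le_refl _

/-- **Good kernels are closed upward**: a kernel dominating a good kernel pointwise is good. [this work] -/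
theorem goodKernel_mono {κ κ' : Fin 15 → Fin 15 → ℤ} (h : ∀ i j, κ i j ≤ κ' i j) (hκ : GoodKernel κ) : GoodKernel κ' :=
  ⟨fun γ _ _ P hmono heqv =>
    le_trans (hκ.nonneg γ P hmono heqv) (Finset.sum_le_sum fun T _ => liftK_mono h (P T) (P Tᶜ))⟩

/-! ## The primed kernels -/

/-- The pair `(ac|by ; ay|bc)` — the two pairings other than `ab|cy` — in both orientations. [this work] -/
def qrPair : Finset (Fin 15 × Fin 15) := {(9, 8), (8, 9)}

/-- The pairs `(a|by|c ; ay|bc)` and `(ac|b|y ; ay|bc)` — a sub-pair of `ac|by` against `ay|bc` — in both orientations.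
[this work] -/
def subQR : Finset (Fin 15 × Fin 15) := {(2, 8), (8, 2), (5, 8), (8, 5)}

/-- **The integer kernel of `2·W′`**: `kerQ44 − [qrPair] − [subQR]`, i.e. Conjecture W's kernel with the three absent types
`(by;ay|bc), (ac;ay|bc), (ac|by;ay|bc)` subtracted at the weight of a `B1` pair. [this work] -/
def kerQ44P (i j : Fin 15) : ℤ := kerQ44 i j - indK qrPair i j - indK subQR i j

/-- **The integer kernel of `4·U′`**: `kerU − 2·[qrPair]`. [this work] -/
def kerUP (i j : Fin 15) : ℤ := kerU i j - 2 * indK qrPair i j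

/-- **The integer kernel of `4·S3′`**: `kerS3 − 2·[qrPair]`. [this work] -/
def kerS3P (i j : Fin 15) : ℤ := kerS3 i j - 2 * indK qrPair i j

/-- `kerQ44P ≤ kerQ44` pointwise. [this work] -/
theorem kerQ44P_le (i j : Fin 15) : kerQ44P i j ≤ kerQ44 i j := by
  unfold kerQ44P indK; split_ifs <;> omega

/-- `kerUP ≤ kerU` pointwise. [this work] -/
theorem kerUP_le (i j : Fin 15) : kerUP i j ≤ kerU i j := by
  unfold kerUP indK; split_ifs <;> omega

/-- `kerS3P ≤ kerS3` pointwise. [this work] -/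
theorem kerS3P_le (i j : Fin 15) : kerS3P i j ≤ kerS3 i j := by
  unfold kerS3P indK; split_ifs <;> omega

/-- **`W′ ⟹ W` at the fibre level.** [this work] -/
theorem goodKernel_kerQ44_of_primed (h : GoodKernel kerQ44P) : GoodKernel kerQ44 := goodKernel_mono kerQ44P_le h

/-- **`U′ ⟹ U` at the fibre level.** [this work] -/
theorem goodKernel_kerU_of_primed (h : GoodKernel kerUP) : GoodKernel kerU := goodKernel_mono kerUP_le h

/-- **`S3′ ⟹ S3` at the fibre level.** [this work] -/
theorem goodKernel_kerS3_of_primed (h : GoodKernel kerS3P) : GoodKernel kerS3 := goodKernel_mono kerS3P_le h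

/-! ## Evaluations -/

/-- The `qrPair` form: `Σ_{p ∈ qrPair} c_{p.1} c_{p.2} = 2·c₈c₉`. [this work] -/
theorem sum_qrPair (c : Fin 15 → ℝ) : (∑ p ∈ qrPair, c p.1 * c p.2) = 2 * (c 8 * c 9) := by
  unfold qrPair; rw [Finset.sum_insert (by decide), Finset.sum_singleton]; ring

/-- The `subQR` form: `Σ_{p ∈ subQR} c_{p.1} c_{p.2} = 2·(c₂c₈ + c₅c₈)`. [this work] -/
theorem sum_subQR (c : Fin 15 → ℝ) : (∑ p ∈ subQR, c p.1 * c p.2) = 2 * (c 2 * c 8 + c 5 * c 8) := by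
  unfold subQR
  rw [Finset.sum_insert (by decide), Finset.sum_insert (by decide), Finset.sum_insert (by decide), Finset.sum_singleton]
  ring

/-- Evaluation of the `W′` kernel form: `Σ κᵢⱼ cᵢ cⱼ = 2(c₁₁+c₁₄)c₀ − 2·B1(c) − D(c) − 2(c₂c₈ + c₅c₈ + c₈c₉)`. [this work] -/
theorem sum_kerQ44P_cell (c : Fin 15 → ℝ) :
    (∑ i : Fin 15, ∑ j : Fin 15, (kerQ44P i j : ℝ) * c i * c j) =
      2 * ((c 11 + c 14) * c 0) -
        2 * (c 11 * c 9 + c 11 * c 8 + c 6 * c 8 + c 6 * c 1 + c 1 * c 8) -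
          (c 2 * c 13 + c 1 * c 13 + c 5 * c 12 + c 1 * c 12 + c 6 * c 10 + c 6 * c 7 + c 2 * c 10 + c 5 * c 7) -
            2 * (c 2 * c 8 + c 5 * c 8 + c 8 * c 9) := by
  have hsplit : ∀ i j : Fin 15, (kerQ44P i j : ℝ) * c i * c j =
      (kerQ44 i j : ℝ) * c i * c j - (indK qrPair i j : ℝ) * c i * c j - (indK subQR i j : ℝ) * c i * c j := by
    intro i j; unfold kerQ44P; push_cast; ring
  simp_rw [hsplit, Finset.sum_sub_distrib]
  rw [sum_kerQ44_cell, sum_indK_cell, sum_indK_cell, sum_qrPair, sum_subQR]; ring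

/-- Evaluation of the `U′` kernel form: `Σ κᵢⱼ cᵢ cⱼ = 4·U(c) − 4·c₈c₉`. [this work] -/
theorem sum_kerUP_cell (c : Fin 15 → ℝ) :
    (∑ i : Fin 15, ∑ j : Fin 15, (kerUP i j : ℝ) * c i * c j) =
      4 * (c 0 * c 14) - 4 * (c 11 * (c 2 + c 3 + c 4 + c 5 + c 8 + c 9)) -
        2 * (c 2 * (c 10 + c 13) + c 3 * (c 10 + c 12) + c 4 * (c 7 + c 13) + c 5 * (c 7 + c 12)) - 4 * (c 8 * c 9) := by
  have hsplit : ∀ i j : Fin 15, (kerUP i j : ℝ) * c i * c j =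
      (kerU i j : ℝ) * c i * c j - 2 * ((indK qrPair i j : ℝ) * c i * c j) := by
    intro i j; unfold kerUP; push_cast; ring
  simp_rw [hsplit, Finset.sum_sub_distrib, ← Finset.mul_sum]
  rw [sum_kerU_cell, sum_indK_cell, sum_qrPair]; ring

/-- Evaluation of the `S3′` kernel form: `Σ κᵢⱼ cᵢ cⱼ = 4·S3(c) − 4·c₈c₉`. [this work] -/
theorem sum_kerS3P_cell (c : Fin 15 → ℝ) :
    (∑ i : Fin 15, ∑ j : Fin 15, (kerS3P i j : ℝ) * c i * c j) =
      4 * (c 0 * (c 11 + c 14)) - 4 * (c 1 * c 6) - 4 * (c 11 * (c 2 + c 3 + c 4 + c 5 + c 8 + c 9)) -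
        2 * (c 2 * (c 10 + c 13) + c 3 * (c 10 + c 12) + c 4 * (c 7 + c 13) + c 5 * (c 7 + c 12)) - 4 * (c 8 * c 9) := by
  have hsplit : ∀ i j : Fin 15, (kerS3P i j : ℝ) * c i * c j =
      (kerS3 i j : ℝ) * c i * c j - 2 * ((indK qrPair i j : ℝ) * c i * c j) := by
    intro i j; unfold kerS3P; push_cast; ring
  simp_rw [hsplit, Finset.sum_sub_distrib, ← Finset.mul_sum]
  rw [sum_kerS3_cell, sum_indK_cell, sum_qrPair]; ring

/-! ## Law level -/

variable {n : ℕ}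

/-- **`W′ ≥ 0` for all `n` from its kernel (the reduction).**  If `kerQ44P` is a good kernel, then on every finite weighted
graph and for all marked points, `2·B1 + D + 2(c₂c₈ + c₅c₈ + c₈c₉) ≤ 2[P(ab|cy)+P(abcy)]·P(a|b|c|y)`. [this work] -/
theorem q44P_cells_of_goodKernel (hK : GoodKernel kerQ44P) (w : Sym2 (Fin n) → unitInterval) (a b c y : Fin n) :
    2 * (cell w a b c y 11 * cell w a b c y 9 + cell w a b c y 11 * cell w a b c y 8 + cell w a b c y 6 * cell w a b c y 8 +
        cell w a b c y 6 * cell w a b c y 1 + cell w a b c y 1 * cell w a b c y 8) +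
      (cell w a b c y 2 * cell w a b c y 13 + cell w a b c y 1 * cell w a b c y 13 + cell w a b c y 5 * cell w a b c y 12 +
        cell w a b c y 1 * cell w a b c y 12 + cell w a b c y 6 * cell w a b c y 10 + cell w a b c y 6 * cell w a b c y 7 +
        cell w a b c y 2 * cell w a b c y 10 + cell w a b c y 5 * cell w a b c y 7) +
      2 * (cell w a b c y 2 * cell w a b c y 8 + cell w a b c y 5 * cell w a b c y 8 + cell w a b c y 8 * cell w a b c y 9) ≤
      2 * ((cell w a b c y 11 + cell w a b c y 14) * cell w a b c y 0) := by
  have h := sum_kernel_cell_nonneg hK w a b c y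
  rw [sum_kerQ44P_cell] at h
  linarith

/-- **Conjecture W from the primed kernel**: `GoodKernel kerQ44P → 2·Q44 ≥ 0` on every finite weighted graph, all `n`.
[this work] -/
theorem q44_cells_of_goodKernel_primed (hK : GoodKernel kerQ44P) (w : Sym2 (Fin n) → unitInterval) (a b c y : Fin n) :
    2 * (cell w a b c y 11 * cell w a b c y 9 + cell w a b c y 11 * cell w a b c y 8 + cell w a b c y 6 * cell w a b c y 8 +
        cell w a b c y 6 * cell w a b c y 1 + cell w a b c y 1 * cell w a b c y 8) +
      (cell w a b c y 2 * cell w a b c y 13 + cell w a b c y 1 * cell w a b c y 13 + cell w a b c y 5 * cell w a b c y 12 +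
        cell w a b c y 1 * cell w a b c y 12 + cell w a b c y 6 * cell w a b c y 10 + cell w a b c y 6 * cell w a b c y 7 +
        cell w a b c y 2 * cell w a b c y 10 + cell w a b c y 5 * cell w a b c y 7) ≤
      2 * ((cell w a b c y 11 + cell w a b c y 14) * cell w a b c y 0) :=
  q44_cells_of_goodKernel (goodKernel_kerQ44_of_primed hK) w a b c y

/-- **`U′ ≥ 0` for all `n` from its kernel.** [this work] -/
theorem packUP_of_goodKernel (hK : GoodKernel kerUP) (w : Sym2 (Fin n) → unitInterval) (a b c y : Fin n) :
    2 * (cell w a b c y 11 * (cell w a b c y 2 + cell w a b c y 3 + cell w a b c y 4 + cell w a b c y 5 + cell w a b c y 8 +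
        cell w a b c y 9)) +
      (cell w a b c y 2 * (cell w a b c y 10 + cell w a b c y 13) + cell w a b c y 3 * (cell w a b c y 10 + cell w a b c y 12) +
        cell w a b c y 4 * (cell w a b c y 7 + cell w a b c y 13) + cell w a b c y 5 * (cell w a b c y 7 + cell w a b c y 12)) +
      2 * (cell w a b c y 8 * cell w a b c y 9) ≤
      2 * (cell w a b c y 0 * cell w a b c y 14) := by
  have h := sum_kernel_cell_nonneg hK w a b c y
  rw [sum_kerUP_cell] at h
  linarith

/-- **`S3′ ≥ 0` for all `n` from its kernel.** [this work] -/
theorem packS3P_of_goodKernel (hK : GoodKernel kerS3P) (w : Sym2 (Fin n) → unitInterval) (a b c y : Fin n) :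
    2 * (cell w a b c y 1 * cell w a b c y 6) +
      2 * (cell w a b c y 11 * (cell w a b c y 2 + cell w a b c y 3 + cell w a b c y 4 + cell w a b c y 5 + cell w a b c y 8 +
        cell w a b c y 9)) +
      (cell w a b c y 2 * (cell w a b c y 10 + cell w a b c y 13) + cell w a b c y 3 * (cell w a b c y 10 + cell w a b c y 12) +
        cell w a b c y 4 * (cell w a b c y 7 + cell w a b c y 13) + cell w a b c y 5 * (cell w a b c y 7 + cell w a b c y 12)) +
      2 * (cell w a b c y 8 * cell w a b c y 9) ≤
      2 * (cell w a b c y 0 * (cell w a b c y 11 + cell w a b c y 14)) := by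
  have h := sum_kernel_cell_nonneg hK w a b c y
  rw [sum_kerS3P_cell] at h
  linarith

/-! ## The open statements -/

/-- **CONJECTURE W′ (fibre form)**: `kerQ44P` is a good kernel, i.e. along every monotone cell map
`#B1-points + #dart-points + #{points of type (by;ay|bc), (ac;ay|bc), (ac|by;ay|bc), either order} ≤ 2·#{AC-goods}`.
OPEN; verified on all monotone maps of `B_k`, `k ≤ 5`, and on the graph fibres listed in the file header; implies Conjecture W
(`q44_cells_of_goodKernel_primed`). [this work] -/
@[conjecture] def ConjWPrime : Prop := GoodKernel kerQ44P

/-- **CONJECTURE U′ (fibre form)**: `kerUP` is a good kernel (`U′ = U − c₈c₉ ≥ 0` on every fibre).  OPEN; same evidence.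
[this work] -/
@[conjecture] def ConjUPrime : Prop := GoodKernel kerUP

/-- **CONJECTURE S3′ (fibre form)**: `kerS3P` is a good kernel (`S3′ = S3 − c₈c₉ ≥ 0` on every fibre).  OPEN; same evidence.
[this work] -/
@[conjecture] def ConjS3Prime : Prop := GoodKernel kerS3P

end TwoCopyMono

end Summit.CriticalPhenomena.PercolationContinuityZ3.Theorems
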